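import Mathlib
import HarnessLib
import Summits.HubbardSuperconductivity.HubbardSuperconductivity.Theorems.KLProgrammeKLRegimeFlowReadScaleZeroMixed

/-!
# Route `KLProgramme`, crux K3 — gen-8 ENGINE-FLOW child (stmt-HubbardSuperconductivity-20437 `KLRegimeEngineV17F2`), stub (C)
# `stub_twoLeg_curvature` at `n = 0`: «EUCLID BRIDGE» + the SIZES-keyed form of the «(C)-SCALE0-MIXED» door

Seat hubbard-kl-k3c3-p1 (g13; row «δμ-flow with klAngularMean constant piece»).  Located item #22a (pen (R127)): the `k = 2` row of (C) at `n = 0` is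
«feasible but tight» through the position-space moment door (k3c5-p1 SCALE0-PT2-SIZING v1 §3: `2b₂D₁² + 2b₁D₂ ≈ 20·c_s` against `c₂ = 2⁴` with the
tree's weight `(1 + |x̃₀| + |x̃₁|)ᵏ`, `≈ 8.8·c_s` with the Euclidean site weight).  The tree's harmonic bound `‖Dʲh_{m,n}‖ ≤ (m+n)ʲ`
(`norm_iteratedFDeriv_harmonicM_le`, Leibniz) is not sharp; the sharp one is `(m² + n²)^{j/2}` (each `cos(m q₀ ± n q₁)` is `cos ∘ ℓ` with
`‖ℓ‖ = √(m²+n²)` on `Momentum = EuclideanSpace ℝ (Fin 2)`).  This file: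

* §1 `norm_iteratedFDeriv_cos_lin_le`: `‖Dʲ(q ↦ cos(a q₀ + b q₁))‖ ≤ √(a²+b²)ʲ`; §2 **`norm_iteratedFDeriv_harmonicM_le_euclid`**: `‖Dʲ h_{m,n}(q)‖ ≤ √(m²+n²)ʲ`;
* §3 **`norm_iteratedFDeriv_evalM_symInterp_le_euclid_moments`**: `‖Dʲ (evalM (symInterp L f)) q‖ ≤ Σ_x √(x̃₀²+x̃₁²)ʲ·|f_c(x)|` (every `j`; the site `x = 0`
  drops by itself for `j ≥ 1` — no «1+», no indicator needed);
* §4 `gridSymbol_jet_le_of_euclid`: for ANY grid element `W`, `‖Dᵏ I_L[loc(map S W)]‖ ≤ (2|P|/(|β|L²))·B` from the `√(Δx̃₀²+Δx̃₁²)ᵏ`-weighted pinned sums (`k ≥ 1`);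
* §5 **`twoLegRead_frameZero_of_split_sizes`**: the «(C)-SCALE0-MIXED» door keyed on MOMENTUM SIZES of the first part's own interpolated symbol
  `G := evalM (symInterp L (loc (map S W_a)))` (`|G| ≤ gv|U| + g₀U²`, `|G − τ_a| ≤ a₀U²`, `‖DᵏG‖ ≤ m_k U²`, `1 ≤ k ≤ 4`) + the on-curve data of
  `H := evalM (symInterp L (loc (map S W_b)))` ⟹ `TwoLegReadJetBound L M cS cS′ … (K₀) 0 ∧ TwoLegReadOscAt L M (2a₀ + 2s₀) … (K₀) 0`,
  `cS = (gv + hv, m₁D₁ + s₁, m₂D₁² + m₁D₂ + s₂, Bell₃(m,D) + s₃, Bell₄(m,D) + s₄)`, `cS′ = (g₀ + h₀, 0, …)` — so ANY weight (the tree's ℓ¹ one via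
  `gridSymbol_jet_le_of_offSite`, the Euclidean one via §4, or a phase-kept time sum) feeds the same slot with a one-line bridge call.

Proofs only; no definitions; inputs are HYPOTHESES (item #22) — nothing here asserts any stub of 20437, K3 or superconductivity.
References: BGM 2006 §2.4 (2.36), §3 (3.2)–(3.3) [cite: BenfattoGiulianiMastropietro2006].
-/

noncomputable section

namespace Summit.HubbardSuperconductivity.HubbardSuperconductivity.Theorems.KLRegimeSplit

set_option linter.dupNamespace false -- summit = problem name (single-conjunct summit), D-0017

open Real Finset Literature.MathematicalPhysics.QuantumLattice Literature.Probability.LatticeModels GrassmannAlgebra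
open Literature.MathematicalPhysics.QuantumLattice.FermiRG Literature.Probability.LatticeModels.BattleFederbush
open Summit.HubbardSuperconductivity.HubbardSuperconductivity.Theorems.KLProgrammeLegKernels
open Summit.HubbardSuperconductivity.HubbardSuperconductivity.Theorems.TwoLegFourier
open Summit.HubbardSuperconductivity.HubbardSuperconductivity.Theorems.EngineV8
open Summit.HubbardSuperconductivity.HubbardSuperconductivity.Theorems.PerturbedFermiCurve
open Summit.HubbardSuperconductivity.HubbardSuperconductivity.Theorems.DispersionFlow

/-! ## §1 A plane wave's cosine: `‖Dʲ cos(a q₀ + b q₁)‖ ≤ √(a²+b²)ʲ` -/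

section Harmonic

/-- Cauchy–Schwarz in the plane, in the form used below: `|a q₀ + b q₁| ≤ √(a²+b²)·‖q‖` on `Momentum`. -/
theorem abs_lin_two_le (a b : ℝ) (q : Momentum) :
    |a * (WithLp.ofLp q) 0 + b * (WithLp.ofLp q) 1| ≤ Real.sqrt (a ^ 2 + b ^ 2) * ‖q‖ := by
  have hq : ‖q‖ = Real.sqrt ((WithLp.ofLp q) 0 ^ 2 + (WithLp.ofLp q) 1 ^ 2) := by
    rw [EuclideanSpace.norm_eq, Fin.sum_univ_two]
    simp only [Real.norm_eq_abs, sq_abs]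
  rw [hq, ← Real.sqrt_mul (by positivity), ← Real.sqrt_sq_eq_abs]
  refine Real.sqrt_le_sqrt ?_
  nlinarith [sq_nonneg (a * (WithLp.ofLp q) 1 - b * (WithLp.ofLp q) 0)]

/-- **`‖Dʲ (q ↦ cos(a·q₀ + b·q₁))‖ ≤ √(a²+b²)ʲ`** (composition of `cos` with a linear functional of norm `≤ √(a²+b²)`). -/
theorem norm_iteratedFDeriv_cos_lin_le (a b : ℝ) (j : ℕ) (q : Momentum) :
    ‖iteratedFDeriv ℝ j (fun q : Momentum => Real.cos (a * (WithLp.ofLp q) 0 + b * (WithLp.ofLp q) 1)) q‖ ≤ Real.sqrt (a ^ 2 + b ^ 2) ^ j := by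
  set Lf : Momentum →L[ℝ] ℝ := a • (PiLp.proj 2 (fun _ : Fin 2 => ℝ) 0 : Momentum →L[ℝ] ℝ) +
    b • (PiLp.proj 2 (fun _ : Fin 2 => ℝ) 1 : Momentum →L[ℝ] ℝ) with hLf
  have hLfq : ∀ q : Momentum, Lf q = a * (WithLp.ofLp q) 0 + b * (WithLp.ofLp q) 1 := fun q => by
    simp [hLf]
  have hfun : (fun q : Momentum => Real.cos (a * (WithLp.ofLp q) 0 + b * (WithLp.ofLp q) 1)) = Real.cos ∘ Lf := by
    funext q; simp [hLfq]
  have hnL : ‖Lf‖ ≤ Real.sqrt (a ^ 2 + b ^ 2) :=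
    ContinuousLinearMap.opNorm_le_bound _ (Real.sqrt_nonneg _) fun q => by
      rw [hLfq, Real.norm_eq_abs]; exact abs_lin_two_le a b q
  rw [hfun, ContinuousLinearMap.iteratedFDeriv_comp_right Lf Real.contDiff_cos q (i := j) le_top]
  refine (ContinuousMultilinearMap.norm_compContinuousLinearMap_le _ _).trans ?_
  rw [Finset.prod_const, Finset.card_univ, Fintype.card_fin, norm_iteratedFDeriv_eq_norm_iteratedDeriv,
    Real.norm_eq_abs]
  calc |iteratedDeriv j Real.cos (Lf q)| * ‖Lf‖ ^ j ≤ 1 * Real.sqrt (a ^ 2 + b ^ 2) ^ j :=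
        mul_le_mul (Real.abs_iteratedDeriv_cos_le_one j _) (pow_le_pow_left₀ (norm_nonneg _) hnL j)
          (by positivity) zero_le_one
    _ = Real.sqrt (a ^ 2 + b ^ 2) ^ j := one_mul _

/-- The plane-wave cosine is smooth. -/
theorem contDiff_cos_lin (a b : ℝ) {k : WithTop ℕ∞} :
    ContDiff ℝ k (fun q : Momentum => Real.cos (a * (WithLp.ofLp q) 0 + b * (WithLp.ofLp q) 1)) :=
  Real.contDiff_cos.comp ((contDiff_const.mul (contDiff_coord 0)).add (contDiff_const.mul (contDiff_coord 1)))

/-! ## §2 The sharp harmonic bound: `‖Dʲ h_{m,n}‖ ≤ √(m²+n²)ʲ` -/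

/-- **`‖Dʲ h_{m,n}(q)‖ ≤ √(m²+n²)ʲ`** for the symmetrised harmonic `h_{m,n}(q) = ½(cos(m q₀)cos(n q₁) + cos(n q₀)cos(m q₁))` — product-to-sum
`= ¼[cos(mq₀+nq₁) + cos(mq₀−nq₁) + cos(nq₀+mq₁) + cos(nq₀−mq₁)]`, each plane wave bounded by §1.  Sharp (the tree's `(m+n)ʲ` is Leibniz). -/
theorem norm_iteratedFDeriv_harmonicM_le_euclid (m n : ℕ) (j : ℕ) (q : Momentum) :
    ‖iteratedFDeriv ℝ j (fun q : Momentum => TrigPolyC4v.harmonic m n (WithLp.ofLp q)) q‖ ≤ Real.sqrt ((m : ℝ) ^ 2 + (n : ℝ) ^ 2) ^ j := by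
  set f₁ : Momentum → ℝ := fun q => Real.cos ((m : ℝ) * (WithLp.ofLp q) 0 + (n : ℝ) * (WithLp.ofLp q) 1) with hf₁
  set f₂ : Momentum → ℝ := fun q => Real.cos ((m : ℝ) * (WithLp.ofLp q) 0 + (-(n : ℝ)) * (WithLp.ofLp q) 1) with hf₂
  set f₃ : Momentum → ℝ := fun q => Real.cos ((n : ℝ) * (WithLp.ofLp q) 0 + (m : ℝ) * (WithLp.ofLp q) 1) with hf₃
  set f₄ : Momentum → ℝ := fun q => Real.cos ((n : ℝ) * (WithLp.ofLp q) 0 + (-(m : ℝ)) * (WithLp.ofLp q) 1) with hf₄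
  have h₁ : ContDiff ℝ ((j : ℕ∞) : WithTop ℕ∞) f₁ := contDiff_cos_lin _ _
  have h₂ : ContDiff ℝ ((j : ℕ∞) : WithTop ℕ∞) f₂ := contDiff_cos_lin _ _
  have h₃ : ContDiff ℝ ((j : ℕ∞) : WithTop ℕ∞) f₃ := contDiff_cos_lin _ _
  have h₄ : ContDiff ℝ ((j : ℕ∞) : WithTop ℕ∞) f₄ := contDiff_cos_lin _ _
  have hfun : (fun q : Momentum => TrigPolyC4v.harmonic m n (WithLp.ofLp q)) = (1 / 4 : ℝ) • (((f₁ + f₂) + f₃) + f₄) := by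
    funext q
    simp only [TrigPolyC4v.harmonic, Pi.smul_apply, Pi.add_apply, smul_eq_mul, hf₁, hf₂, hf₃, hf₄, neg_mul, ← sub_eq_add_neg,
      Real.cos_add, Real.cos_sub]
    ring
  have h₁₂ : ContDiff ℝ ((j : ℕ∞) : WithTop ℕ∞) (f₁ + f₂) := h₁.add h₂
  have h₁₂₃ : ContDiff ℝ ((j : ℕ∞) : WithTop ℕ∞) ((f₁ + f₂) + f₃) := h₁₂.add h₃
  have h₁₂₃₄ : ContDiff ℝ ((j : ℕ∞) : WithTop ℕ∞) (((f₁ + f₂) + f₃) + f₄) := h₁₂₃.add h₄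
  rw [hfun, iteratedFDeriv_const_smul_apply h₁₂₃₄.contDiffAt, iteratedFDeriv_add_apply h₁₂₃.contDiffAt h₄.contDiffAt,
    iteratedFDeriv_add_apply h₁₂.contDiffAt h₃.contDiffAt, iteratedFDeriv_add_apply h₁.contDiffAt h₂.contDiffAt, norm_smul]
  have e₁ := norm_iteratedFDeriv_cos_lin_le (m : ℝ) (n : ℝ) j q
  have e₂ := norm_iteratedFDeriv_cos_lin_le (m : ℝ) (-(n : ℝ)) j q
  have e₃ := norm_iteratedFDeriv_cos_lin_le (n : ℝ) (m : ℝ) j q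
  have e₄ := norm_iteratedFDeriv_cos_lin_le (n : ℝ) (-(m : ℝ)) j q
  rw [neg_sq] at e₂ e₄
  rw [show (n : ℝ) ^ 2 + (m : ℝ) ^ 2 = (m : ℝ) ^ 2 + (n : ℝ) ^ 2 by ring] at e₃ e₄
  have hsum := (norm_add_le _ _).trans (add_le_add ((norm_add_le _ _).trans (add_le_add ((norm_add_le _ _).trans (add_le_add e₁ e₂)) e₃)) e₄)
  rw [Real.norm_eq_abs, abs_of_pos (by norm_num : (0 : ℝ) < 1 / 4)]
  linarith

end Harmonic

/-! ## §3 Derivatives of the interpolant from the EUCLIDEAN moments -/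

section Interp

variable (L : ℕ) [NeZero L]

/-- **`‖Dʲ (evalM (symInterp L f)) q‖ ≤ Σ_x √(x̃₀²+x̃₁²)ʲ·|f_c(x)|`** for every order `j` and every `q` — Euclidean site weight, no «1+»; for `j ≥ 1`
the site `x = 0` contributes nothing by itself. -/
theorem norm_iteratedFDeriv_evalM_symInterp_le_euclid_moments (f : TorusSite 2 L → ℝ) (j : ℕ) (q : Momentum) :
    ‖iteratedFDeriv ℝ j (evalM (symInterp L f)) q‖ ≤
      ∑ x : TorusSite 2 L, Real.sqrt (((x 0).valMinAbs.natAbs : ℝ) ^ 2 + ((x 1).valMinAbs.natAbs : ℝ) ^ 2) ^ j * |torusCosCoeff L f x| := by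
  have hfun : evalM (symInterp L f) = fun q : Momentum => ∑ x : TorusSite 2 L,
      (fun q : Momentum => torusCosCoeff L f x * TrigPolyC4v.harmonic (x 0).valMinAbs.natAbs (x 1).valMinAbs.natAbs (WithLp.ofLp q)) q := by
    funext q
    simp only [evalM_apply, eval_symInterp]
  have hterm : ∀ x : TorusSite 2 L, ContDiff ℝ ((j : ℕ∞) : WithTop ℕ∞)
      (fun q : Momentum => torusCosCoeff L f x * TrigPolyC4v.harmonic (x 0).valMinAbs.natAbs (x 1).valMinAbs.natAbs (WithLp.ofLp q)) :=
    fun x => contDiff_const.mul (contDiff_harmonicM _ _)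
  rw [hfun, iteratedFDeriv_fun_sum_apply fun x _ => (hterm x).contDiffAt]
  refine (norm_sum_le _ _).trans (sum_le_sum fun x _ => ?_)
  have hsm : (fun q : Momentum => torusCosCoeff L f x *
      TrigPolyC4v.harmonic (x 0).valMinAbs.natAbs (x 1).valMinAbs.natAbs (WithLp.ofLp q)) =
      torusCosCoeff L f x • fun q : Momentum => TrigPolyC4v.harmonic (x 0).valMinAbs.natAbs (x 1).valMinAbs.natAbs (WithLp.ofLp q) := by
    funext q; simp [smul_eq_mul]
  rw [hsm, iteratedFDeriv_const_smul_apply ((contDiff_harmonicM _ _ (k := ((j : ℕ∞) : WithTop ℕ∞))).contDiffAt), norm_smul,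
    Real.norm_eq_abs, mul_comm]
  exact mul_le_mul_of_nonneg_right (norm_iteratedFDeriv_harmonicM_le_euclid _ _ j q) (abs_nonneg _)

end Interp

/-! ## §4 A grid element's interpolated symbol: momentum sup-jets from the EUCLIDEAN-weighted pinned sums -/

section Grid

variable {L M : ℕ} [NeZero L] [NeZero M] {P : Type*} [Fintype P] [DecidableEq P]

omit [NeZero L] in
/-- The Euclidean site weight is even. -/
theorem euclidWeight_neg (k : ℕ) (z : TorusSite 2 L) :
    Real.sqrt ((((-z) 0).valMinAbs.natAbs : ℝ) ^ 2 + (((-z) 1).valMinAbs.natAbs : ℝ) ^ 2) ^ k =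
      Real.sqrt (((z 0).valMinAbs.natAbs : ℝ) ^ 2 + ((z 1).valMinAbs.natAbs : ℝ) ^ 2) ^ k := by
  simp only [Pi.neg_apply, ZMod.natAbs_valMinAbs_neg]

/-- **Momentum sup-jet of order `k ≥ 1` of a grid element's interpolated symbol from the EUCLIDEAN-weighted pinned sum** (weight
`√(Δx̃₀²+Δx̃₁²)ᵏ`, which vanishes on the site diagonal by itself): `‖Dᵏ evalM (symInterp L (loc (map S W))) q‖ ≤ (2|P|/(|β|L²))·B`. -/
theorem gridSymbol_jet_le_of_euclid {β : ℝ} (hβ : β ≠ 0) (x : P → TorusSite 2 L) (τ : P → ℝ) (W : GrassmannAlgebra ℂ (GridLeg P)) {k : ℕ}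
    (hk : 1 ≤ k) {B : ℝ}
    (hBk : ∀ (σ : Fin 2) (p₀ : P), ∑ p₁ : P,
      Real.sqrt ((((x p₁ - x p₀) 0).valMinAbs.natAbs : ℝ) ^ 2 + (((x p₁ - x p₀) 1).valMinAbs.natAbs : ℝ) ^ 2) ^ k *
        ‖kernel ℂ W 2 (fun i => ((![p₀, p₁] i, σ), i))‖ ≤ B) (q : Momentum) :
    ‖iteratedFDeriv ℝ k (evalM (symInterp L (fun p : TorusSite 2 L =>
        (∑ σ : Fin 2, ((selfEnergy L M β (ExteriorAlgebra.map (Matrix.toLin' (gridSubMatrix L M β x τ)) W) (omega0 M, p) σ).re +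
          (selfEnergy L M β (ExteriorAlgebra.map (Matrix.toLin' (gridSubMatrix L M β x τ)) W) ((omega0 M).rev, p) σ).re)) / 4))) q‖ ≤
      2 * (Fintype.card P : ℝ) / (|β| * (L : ℝ) ^ 2) * B := by
  have _ := hk
  refine (norm_iteratedFDeriv_evalM_symInterp_le_euclid_moments L _ k q).trans ?_
  set w : TorusSite 2 L → ℝ := fun z => Real.sqrt (((z 0).valMinAbs.natAbs : ℝ) ^ 2 + ((z 1).valMinAbs.natAbs : ℝ) ^ 2) ^ k with hw
  have hw0 : ∀ z, 0 ≤ w z := fun z => by rw [hw]; positivity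
  have hweven : ∀ z, w (-z) = w z := fun z => by simp only [hw]; exact euclidWeight_neg k z
  exact sum_evenWeight_abs_torusCosCoeff_locRe_map_gridSub_le (L := L) (M := M) hβ x τ W hw0 hweven (B := B) (fun σ p₀ => hBk σ p₀)

end Grid

/-! ## §5 The «(C)-SCALE0-MIXED» door keyed on MOMENTUM SIZES of the first part -/

section Door

variable {L M : ℕ} [NeZero L] [NeZero M] {μ U β : ℝ}

/-- **(C) AT `n = 0` FROM A SPLIT GRID ELEMENT — SIZES-KEYED.**  `W₀ := effAction (S_{4M}ᵀ C⁰_{>e₀} S_{4M}) V_{4M} = W_a + W_b`;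
`G := evalM (symInterp L (loc (map S_{4M} W_a)))`, `H := evalM (symInterp L (loc (map S_{4M} W_b)))`, `γ₀ := toLp ∘ klFermiPoint μ 0 ∈ C⁴` with
`‖γ₀^{(i)}‖ ≤ D i`.  If `|G q| ≤ gv|U| + g₀U²`, `|G q − τ_a| ≤ a₀U²`, `‖DᵏG q‖ ≤ m_k U²` (`1 ≤ k ≤ 4`, every continuum `q` — from ANY bridge: ℓ¹ weight
`gridSymbol_jet_le_of_offSite`, Euclidean `gridSymbol_jet_le_of_euclid`, …) and `|H(γ₀θ)| ≤ hv|U| + h₀U²`, `|H(γ₀θ) − τ_b| ≤ s₀U²`,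
`|∂θᵏ(H∘γ₀)| ≤ s_kU²`, then `TwoLegReadJetBound L M cS cS′ β U μ (K₀) 0 ∧ TwoLegReadOscAt L M (2a₀ + 2s₀) β U μ (K₀) 0`,
`cS = (gv + hv, m₁D₁ + s₁, m₂D₁² + m₁D₂ + s₂, m₃D₁³ + 3m₂D₁D₂ + m₁D₃ + s₃, m₄D₁⁴ + 6m₃D₁²D₂ + 3m₂D₂² + 4m₂D₁D₃ + m₁D₄ + s₄, 0, …)`, `cS′ = (g₀ + h₀, 0, …)`. -/
theorem twoLegRead_frameZero_of_split_sizes (hβ : klBetaMin ≤ β) {gv g0 a0 τa hv h0 τb : ℝ} {m D s : ℕ → ℝ}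
    (Wa Wb : GrassmannAlgebra ℂ (GridLeg (GridPoint L (2 * (2 * M)))))
    (hsplit : effAction ℂ ((hubbardGridSub L M β (2 * (2 * M))).transpose * hubbardCovAboveCT L M β μ 0 0 klE0 *
        hubbardGridSub L M β (2 * (2 * M))) (hubbardGridInteraction L (2 * (2 * M)) β U) = Wa + Wb)
    (hGval : ∀ q : Momentum, |evalM (symInterp L (fun p : TorusSite 2 L =>
        (∑ σ : Fin 2, ((selfEnergy L M β (ExteriorAlgebra.map (Matrix.toLin' (gridSubMatrix L M β
            (fun p : GridPoint L (2 * (2 * M)) => p.2) (fun p => gridTime β (2 * (2 * M)) p.1))) Wa) (omega0 M, p) σ).re +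
          (selfEnergy L M β (ExteriorAlgebra.map (Matrix.toLin' (gridSubMatrix L M β
            (fun p : GridPoint L (2 * (2 * M)) => p.2) (fun p => gridTime β (2 * (2 * M)) p.1))) Wa) ((omega0 M).rev, p) σ).re)) / 4)) q| ≤
        gv * |U| + g0 * U ^ 2)
    (hGτ : ∀ q : Momentum, |evalM (symInterp L (fun p : TorusSite 2 L =>
        (∑ σ : Fin 2, ((selfEnergy L M β (ExteriorAlgebra.map (Matrix.toLin' (gridSubMatrix L M β
            (fun p : GridPoint L (2 * (2 * M)) => p.2) (fun p => gridTime β (2 * (2 * M)) p.1))) Wa) (omega0 M, p) σ).re +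
          (selfEnergy L M β (ExteriorAlgebra.map (Matrix.toLin' (gridSubMatrix L M β
            (fun p : GridPoint L (2 * (2 * M)) => p.2) (fun p => gridTime β (2 * (2 * M)) p.1))) Wa) ((omega0 M).rev, p) σ).re)) / 4)) q - τa| ≤
        a0 * U ^ 2)
    (hGjet : ∀ k, 1 ≤ k → k ≤ 4 → ∀ q : Momentum, ‖iteratedFDeriv ℝ k (evalM (symInterp L (fun p : TorusSite 2 L =>
        (∑ σ : Fin 2, ((selfEnergy L M β (ExteriorAlgebra.map (Matrix.toLin' (gridSubMatrix L M β
            (fun p : GridPoint L (2 * (2 * M)) => p.2) (fun p => gridTime β (2 * (2 * M)) p.1))) Wa) (omega0 M, p) σ).re +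
          (selfEnergy L M β (ExteriorAlgebra.map (Matrix.toLin' (gridSubMatrix L M β
            (fun p : GridPoint L (2 * (2 * M)) => p.2) (fun p => gridTime β (2 * (2 * M)) p.1))) Wa) ((omega0 M).rev, p) σ).re)) / 4))) q‖ ≤
        m k * U ^ 2)
    (hγ : ContDiff ℝ 4 fun θ : ℝ => (WithLp.toLp 2 (klFermiPoint μ 0 θ) : Momentum))
    (hD : ∀ θ : ℝ, ∀ i, 1 ≤ i → i ≤ 4 → ‖iteratedDeriv i (fun θ : ℝ => (WithLp.toLp 2 (klFermiPoint μ 0 θ) : Momentum)) θ‖ ≤ D i)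
    (hHval : ∀ θ : ℝ, |evalM (symInterp L (fun p : TorusSite 2 L =>
        (∑ σ : Fin 2, ((selfEnergy L M β (ExteriorAlgebra.map (Matrix.toLin' (gridSubMatrix L M β
            (fun p : GridPoint L (2 * (2 * M)) => p.2) (fun p => gridTime β (2 * (2 * M)) p.1))) Wb) (omega0 M, p) σ).re +
          (selfEnergy L M β (ExteriorAlgebra.map (Matrix.toLin' (gridSubMatrix L M β
            (fun p : GridPoint L (2 * (2 * M)) => p.2) (fun p => gridTime β (2 * (2 * M)) p.1))) Wb) ((omega0 M).rev, p) σ).re)) / 4))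
        (WithLp.toLp 2 (klFermiPoint μ 0 θ))| ≤ hv * |U| + h0 * U ^ 2)
    (hHτ : ∀ θ : ℝ, |evalM (symInterp L (fun p : TorusSite 2 L =>
        (∑ σ : Fin 2, ((selfEnergy L M β (ExteriorAlgebra.map (Matrix.toLin' (gridSubMatrix L M β
            (fun p : GridPoint L (2 * (2 * M)) => p.2) (fun p => gridTime β (2 * (2 * M)) p.1))) Wb) (omega0 M, p) σ).re +
          (selfEnergy L M β (ExteriorAlgebra.map (Matrix.toLin' (gridSubMatrix L M β
            (fun p : GridPoint L (2 * (2 * M)) => p.2) (fun p => gridTime β (2 * (2 * M)) p.1))) Wb) ((omega0 M).rev, p) σ).re)) / 4))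
        (WithLp.toLp 2 (klFermiPoint μ 0 θ)) - τb| ≤ s 0 * U ^ 2)
    (hHjet : ∀ k, 1 ≤ k → k ≤ 4 → ∀ θ : ℝ, |iteratedDeriv k (fun θ : ℝ => evalM (symInterp L (fun p : TorusSite 2 L =>
        (∑ σ : Fin 2, ((selfEnergy L M β (ExteriorAlgebra.map (Matrix.toLin' (gridSubMatrix L M β
            (fun p : GridPoint L (2 * (2 * M)) => p.2) (fun p => gridTime β (2 * (2 * M)) p.1))) Wb) (omega0 M, p) σ).re +
          (selfEnergy L M β (ExteriorAlgebra.map (Matrix.toLin' (gridSubMatrix L M β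
            (fun p : GridPoint L (2 * (2 * M)) => p.2) (fun p => gridTime β (2 * (2 * M)) p.1))) Wb) ((omega0 M).rev, p) σ).re)) / 4))
        (WithLp.toLp 2 (klFermiPoint μ 0 θ))) θ| ≤ s k * U ^ 2) :
    TwoLegReadJetBound L M
        (fun k => if k = 0 then gv + hv else if k = 1 then m 1 * D 1 + s 1 else if k = 2 then m 2 * D 1 ^ 2 + m 1 * D 2 + s 2
          else if k = 3 then m 3 * D 1 ^ 3 + 3 * m 2 * D 1 * D 2 + m 1 * D 3 + s 3
          else if k = 4 then m 4 * D 1 ^ 4 + 6 * m 3 * D 1 ^ 2 * D 2 + 3 * m 2 * D 2 ^ 2 + 4 * m 2 * D 1 * D 3 + m 1 * D 4 + s 4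
          else 0)
        (fun k => if k = 0 then g0 + h0 else 0) β U μ (klFlowFrameU L M β U μ 0) 0 ∧
      TwoLegReadOscAt L M (2 * a0 + 2 * s 0) β U μ (klFlowFrameU L M β U μ 0) 0 := by
  have hβ0 : 0 < β := lt_of_lt_of_le (by norm_num [klBetaMin]) hβ
  set xg : GridPoint L (2 * (2 * M)) → TorusSite 2 L := fun p => p.2 with hxg
  set τg : GridPoint L (2 * (2 * M)) → ℝ := fun p => gridTime β (2 * (2 * M)) p.1 with hτg
  set Xa : HubbardGrassmann L M := ExteriorAlgebra.map (Matrix.toLin' (gridSubMatrix L M β xg τg)) Wa with hXa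
  set Xb : HubbardGrassmann L M := ExteriorAlgebra.map (Matrix.toLin' (gridSubMatrix L M β xg τg)) Wb with hXb
  set fa : TorusSite 2 L → ℝ := fun p => (∑ σ : Fin 2, ((selfEnergy L M β Xa (omega0 M, p) σ).re +
    (selfEnergy L M β Xa ((omega0 M).rev, p) σ).re)) / 4 with hfa
  set fb : TorusSite 2 L → ℝ := fun p => (∑ σ : Fin 2, ((selfEnergy L M β Xb (omega0 M, p) σ).re +
    (selfEnergy L M β Xb ((omega0 M).rev, p) σ).re)) / 4 with hfb
  set G : Momentum → ℝ := evalM (symInterp L fa) with hG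
  set H : Momentum → ℝ := evalM (symInterp L fb) with hH
  set γ : ℝ → Momentum := fun θ : ℝ => (WithLp.toLp 2 (klFermiPoint μ 0 θ) : Momentum) with hγdef
  -- the scale-0 symbol is `loc(map S W₀)` and `W₀ = W_a + W_b`
  have hrep : klLocSelfEnergyRe L M β U μ 0 0 = fa + fb := by
    have hmap : ExteriorAlgebra.map (Matrix.toLin' (gridSubMatrix L M β xg τg))
        (effAction ℂ ((hubbardGridSub L M β (2 * (2 * M))).transpose * hubbardCovAboveCT L M β μ 0 0 klE0 *
          hubbardGridSub L M β (2 * (2 * M))) (hubbardGridInteraction L (2 * (2 * M)) β U)) = Xa + Xb := by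
      rw [hsplit, map_add]
    have hW := klEffectiveAction_zero_frameZero_eq_map_gridSub (L := L) (M := M) hβ0.ne' U μ
    rw [hmap] at hW
    rw [← locSymbol_add β Xa Xb]
    funext p
    have h := klLocSelfEnergyRe_sub_frame_eq_locRe (L := L) (M := M) hβ0.ne' U μ 0 0 p
    rw [hW, TrigPolyC4v.eval_zero, sub_zero] at h
    exact h
  set F : Momentum → ℝ := evalM (symInterp L (klLocSelfEnergyRe L M β U μ 0 0)) with hF
  have hFGH : F = G + H := by rw [hF, hrep, evalM_symInterp_add_fun]
  have hGc : ContDiff ℝ 4 G := contDiff_evalM _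
  have hHc : ContDiff ℝ 4 H := contDiff_evalM _
  have hνF : klLocalPart L M β U μ 0 0 = F ∘ γ := by
    have h := klLocalPart_zero_sub_frame_eq_comp (L := L) (M := M) β U μ (0 : TrigPolyC4v)
    have hl : (fun θ => klLocalPart L M β U μ 0 0 θ - (0 : TrigPolyC4v).eval (klFermiPoint μ 0 θ)) = klLocalPart L M β U μ 0 0 := by
      funext θ; simp
    rw [hl] at h
    rw [h]
    congr 1
    funext p
    simp [hF, evalM_apply]
  have hGγ : ContDiff ℝ 4 (G ∘ γ) := hGc.comp hγ
  have hHγ : ContDiff ℝ 4 (H ∘ γ) := hHc.comp hγ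
  have hC : ContDiff ℝ 4 (fun θ : ℝ => klLocalPart L M β U μ 0 0 θ) := by
    rw [show (fun θ : ℝ => klLocalPart L M β U μ 0 0 θ) = klLocalPart L M β U μ 0 0 from rfl, hνF, hFGH]
    exact hGγ.add hHγ
  have hval : ∀ θ, klLocalPart L M β U μ 0 0 θ = G (γ θ) + H (γ θ) := fun θ => by
    have h := congrFun hνF θ
    rw [hFGH] at h
    exact h
  have haddθ : ∀ k ≤ 4, ∀ θ, iteratedDeriv k (fun θ : ℝ => klLocalPart L M β U μ 0 0 θ) θ =
      iteratedDeriv k (G ∘ γ) θ + iteratedDeriv k (H ∘ γ) θ := by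
    intro k hk4 θ
    rw [show (fun θ : ℝ => klLocalPart L M β U μ 0 0 θ) = klLocalPart L M β U μ 0 0 from rfl, hνF, hFGH]
    have hk' : ((k : ℕ) : WithTop ℕ∞) ≤ 4 := by exact_mod_cast hk4
    show iteratedDeriv k ((G ∘ γ) + (H ∘ γ)) θ = _
    exact iteratedDeriv_add ((hGγ.of_le hk').contDiffAt) ((hHγ.of_le hk').contDiffAt)
  -- the data in the local names
  have hGval' : ∀ q, |G q| ≤ gv * |U| + g0 * U ^ 2 := hGval
  have hGτ' : ∀ q, |G q - τa| ≤ a0 * U ^ 2 := hGτ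
  have hGjet' : ∀ k, 1 ≤ k → k ≤ 4 → ∀ q, ‖iteratedFDeriv ℝ k G q‖ ≤ m k * U ^ 2 := hGjet
  have hHval' : ∀ θ, |H (γ θ)| ≤ hv * |U| + h0 * U ^ 2 := hHval
  have hHτ' : ∀ θ, |H (γ θ) - τb| ≤ s 0 * U ^ 2 := hHτ
  have hHjet' : ∀ k, 1 ≤ k → k ≤ 4 → ∀ θ, |iteratedDeriv k (H ∘ γ) θ| ≤ s k * U ^ 2 := hHjet
  have hjets : TwoLegReadJetBound L M
      (fun k => if k = 0 then gv + hv else if k = 1 then m 1 * D 1 + s 1 else if k = 2 then m 2 * D 1 ^ 2 + m 1 * D 2 + s 2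
        else if k = 3 then m 3 * D 1 ^ 3 + 3 * m 2 * D 1 * D 2 + m 1 * D 3 + s 3
        else if k = 4 then m 4 * D 1 ^ 4 + 6 * m 3 * D 1 ^ 2 * D 2 + 3 * m 2 * D 2 ^ 2 + 4 * m 2 * D 1 * D 3 + m 1 * D 4 + s 4
        else 0)
      (fun k => if k = 0 then g0 + h0 else 0) β U μ (klFlowFrameU L M β U μ 0) 0 := by
    rw [klFlowFrameU_zero]
    refine ⟨hC, fun k hk4 θ => ?_⟩
    rcases Nat.eq_zero_or_pos k with rfl | hkpos
    · rw [iteratedDeriv_zero, hval θ]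
      refine (abs_add_le _ _).trans ((add_le_add (hGval' (γ θ)) (hHval' θ)).trans (le_of_eq ?_))
      simp only [if_true, curveJetBar, uPow, Nat.cast_zero, zero_sub, mul_zero, zpow_zero, mul_one]
      rw [show U ^ 2 = |U| * |U| by rw [← sq, sq_abs]]; ring
    · have hkne : k ≠ 0 := by omega
      obtain ⟨h1, h2, h3, h4⟩ := abs_iteratedDeriv_comp_le_bell hGc hγ (θ := θ) (M := fun k => m k * U ^ 2) (D := D)
        (fun l hl1 hl4 => hGjet' l hl1 hl4 _) (hD θ)
      rw [haddθ k hk4 θ]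
      interval_cases k
      · refine (abs_add_le _ _).trans ((add_le_add h1 (hHjet' 1 le_rfl (by norm_num) θ)).trans (le_of_eq ?_))
        simp [curveJetBar, uPow]; ring
      · refine (abs_add_le _ _).trans ((add_le_add h2 (hHjet' 2 (by norm_num) (by norm_num) θ)).trans (le_of_eq ?_))
        simp [curveJetBar, uPow]; ring
      · refine (abs_add_le _ _).trans ((add_le_add h3 (hHjet' 3 (by norm_num) (by norm_num) θ)).trans (le_of_eq ?_))
        simp [curveJetBar, uPow]; ring
      · refine (abs_add_le _ _).trans ((add_le_add h4 (hHjet' 4 (by norm_num) le_rfl θ)).trans (le_of_eq ?_))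
        simp [curveJetBar, uPow]; ring
  refine ⟨hjets, ?_⟩
  have hA : ∀ θ : ℝ, |klTwoLegCurveProfile L M β U μ 0 0 θ - (τa + τb)| ≤ (a0 + s 0) * U ^ 2 := by
    intro θ
    rw [← C4a.klLocalPart_zero_frame_eq_profile β U μ θ, hval θ]
    calc |G (γ θ) + H (γ θ) - (τa + τb)| = |(G (γ θ) - τa) + (H (γ θ) - τb)| := by ring_nf
      _ ≤ |G (γ θ) - τa| + |H (γ θ) - τb| := abs_add_le _ _
      _ ≤ a0 * U ^ 2 + s 0 * U ^ 2 := add_le_add (hGτ' (γ θ)) (hHτ' θ)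
      _ = (a0 + s 0) * U ^ 2 := by ring
  exact twoLegReadOscAt_zero_of_structured hC.continuous hA (by linarith)

end Door

end Summit.HubbardSuperconductivity.HubbardSuperconductivity.Theorems.KLRegimeSplit

end
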